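import Mathlib
import Summits.CriticalPhenomena.CardyFormulaZ2.Theorems.CardySelfRefinementDefs
import Summits.CriticalPhenomena.CardyFormulaZ2.Theorems.CardySelfRefinementGradientComparabilityStubDcEqSumPivotal
import Summits.CriticalPhenomena.CardyFormulaZ2.Theorems.CardySelfRefinementGradientComparabilityKernelsDictionary
import HarnessLib

/-!
# Crux `GradientComparability` (stmt-CriticalPhenomena-10269), line `monotone-product-coordinates` —
# registered sub-goal `slopeBounds_corner` (CORNER clause of `stub_slopeBounds`): reduction

Route `CardySelfRefinement`, sub-problem `CriticalPhenomena/CardyFormulaZ2`; vocabulary from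
`CardySelfRefinementDefs` (`M`, `P`, `Dρ`, `Dc`, `PathOK`, `window`, `Aloc`, `edgeOf`, `ax`).

The corner clause of `stub_slopeBounds` says: for `k = 2, 3` and a nonempty quad family there is
`δ ∈ (0, ¼]` such that for all levels `0 < vlo < vhi < 1`, with a MESH-UNIFORM constant `C`,
`|∂cP(ρ,c)| ≤ C |∂ρP(ρ,c)|` at every point of the corner level band
`{ρ ∈ [1 - 2δ, 1], c ∈ [0,1], P_η(ρ,c) ∈ [vlo, vhi]}` and every small mesh.  Near the corner
`(1,0)` the level band hugs the critical curve `c*(ρ) → 0` (`ρ → 1`); the clause has two inputs of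
different nature, which this file separates (pure bookkeeping, no percolation estimate):

* **(LOC) the local corner slope bound** (hypothesis `hloc` of
  `slopeBounds_corner_of_localSlope_of_confinement`): the clause restricted to SMALL interior
  density `c ∈ [0, c₀]`, `c₀ = c₀(k, F) > 0` chosen together with `δ` BEFORE the levels.  This is
  the near-critical comparison of the two Russo sums at the corner (`∂cP = Σ_{interior e} M(e
  pivotal)`, `stub_Dc_eq_sum_pivotal`; `∂ρP = Σ_bundles` selector influences,
  `stub_Drho_eq_signed_sum`, at `ρ = 1` minus the untie influences, `Drho_one_eq_sum_untie`).
  `cornerLocalSlope_of_signedDomination` derives (LOC) from the **signed domination inequality**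
  `a · ∂cP ≤ ∂ρP + B · c · ∂cP` on the band for `c ≤ c₁` (the shape a cell-scale surgery delivers:
  every interior pivotal edge forces, after a bounded-cost local modification, an AND-pivotal
  bundle of its cell, `∂cP ≤ C₂ N_AND`, while the negative selector patterns cost an open interior
  edge at a bundle-interior vertex, `∂ρP ≥ (½ - 2^{-k}) N_AND - B c ∂cP`, cf. the `k = 2`
  graph-crossing cone `Cone2.selector_section_sub_ge` of crux `CriticalPathRSW`): with
  `c₀ = min c₁ (a / (2(|B|+1)))` one gets `∂cP ≤ (2/a) ∂ρP`.
* **(CONF) corner band confinement** (hypothesis `hconf`): for every `c₀ > 0` there is `δ > 0`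
  such that `P_η(ρ, c₀) → 1` as `η → 0⁺` uniformly in `ρ ∈ [1 - 2δ, 1]`; by monotonicity of `P` in
  `c` (`P_mono_c`) no band point with `ρ ≥ 1 - 2δ` has `c > c₀`.  This is supercriticality of the
  cell-interior enhancement of critical coarse percolation near the corner (`c*(ρ) → 0` as
  `ρ → 1`, an Aizenman–Grimmett essential-enhancement statement for `M_k`), not in the tree.

`slopeBounds_corner_of_localSlope_of_confinement : (LOC) → (CONF) → slopeBounds_corner` is the
registered reduction (`δ = min δ_LOC δ_CONF ¼`, `η₁ = min`, case split `c ≤ c₀` / `c > c₀`).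
-/

noncomputable section

namespace Summit.CriticalPhenomena.CardyFormulaZ2.Theorems.CardySelfRefinement

open scoped Topology
open Filter Set MeasureTheory
open Literature.Probability.LatticeModels Literature.Probability.Percolation
open Literature.Probability.Percolation.QuadCrossing
open Summit.CriticalPhenomena.CardyFormulaZ2.Theses.CardySelfRefinement

/-! ## `∂cP ≥ 0` -/

/-- **`∂cP ≥ 0` on `[0,1]`** (for `η ≠ 0`): by the Russo dictionary `stub_Dc_eq_sum_pivotal`,
`∂cP(ρ,c)` is a finite sum of probabilities (of pivotality of the non-axial window edges). -/
theorem Dc_nonneg_of_mem_Icc (k m : ℕ) (F : Fin m → Quad (Set.univ : Set ℂ)) {η : ℝ} (hη : η ≠ 0)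
    (ρ : ℝ) {c : ℝ} (hc : c ∈ Set.Icc (0 : ℝ) 1) : 0 ≤ Dc k m F η (ρ, c) := by
  classical
  obtain ⟨W, hW⟩ : ∃ W : Finset (Sym2 (Site 2)),
      ∀ e, e ∈ W ↔ e ∈ window m F η ∧ ∃ (v : Site 2) (d : Fin 2), e = edgeOf (v, d) ∧ ¬ ax k (v, d) := by
    refine ⟨(window_finite m F hη).toFinset.filter
      (fun e => ∃ (v : Site 2) (d : Fin 2), e = edgeOf (v, d) ∧ ¬ ax k (v, d)), fun e => ?_⟩
    simp only [Finset.mem_filter, Set.Finite.mem_toFinset]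
  rw [stub_Dc_eq_sum_pivotal k m F hη ρ hc W hW]
  exact Finset.sum_nonneg fun e _ => by positivity

/-! ## (LOC) from the signed domination inequality -/

/-- **The local corner slope bound from signed domination.**  Fix `k, m, F`.  If there are
`δ, a, c₁ > 0` and `B` such that for all levels `0 < vlo < vhi < 1` and all small meshes the
SIGNED DOMINATION inequality `a · ∂cP(ρ,c) ≤ ∂ρP(ρ,c) + B · c · ∂cP(ρ,c)` holds at every band point
with `ρ ∈ [1 - 2δ, 1]`, `c ∈ [0, c₁]`, then the corner clause holds on `c ∈ [0, c₀]`,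
`c₀ = min (min c₁ 1) (a / (2(|B|+1)))`, with `C = 2/a`: indeed `B c ∂cP ≤ (a/2) ∂cP` there
(`∂cP ≥ 0`, `Dc_nonneg_of_mem_Icc`), so `(a/2) ∂cP ≤ ∂ρP ≤ |∂ρP|`. -/
theorem cornerLocalSlope_of_signedDomination (k m : ℕ) (F : Fin m → Quad (Set.univ : Set ℂ))
    (hSD : ∃ δ a B c₁ : ℝ, 0 < δ ∧ 0 < a ∧ 0 < c₁ ∧ ∀ vlo vhi : ℝ, 0 < vlo → vlo < vhi → vhi < 1 →
      ∃ η₀ : ℝ, 0 < η₀ ∧ ∀ η ∈ Set.Ioo 0 η₀, ∀ ρ ∈ Set.Icc (1 - 2 * δ) 1, ∀ c ∈ Set.Icc (0 : ℝ) c₁,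
        P k m F η ρ c ∈ Set.Icc vlo vhi →
          a * Dc k m F η (ρ, c) ≤ Dρ k m F η (ρ, c) + B * c * Dc k m F η (ρ, c)) :
    ∃ δ c₀ : ℝ, 0 < δ ∧ 0 < c₀ ∧ ∀ vlo vhi : ℝ, 0 < vlo → vlo < vhi → vhi < 1 →
      ∃ C η₁ : ℝ, 0 < η₁ ∧ ∀ η ∈ Set.Ioo 0 η₁, ∀ ρ ∈ Set.Icc (1 - 2 * δ) 1, ∀ c ∈ Set.Icc (0 : ℝ) c₀,
        P k m F η ρ c ∈ Set.Icc vlo vhi → |Dc k m F η (ρ, c)| ≤ C * |Dρ k m F η (ρ, c)| := by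
  obtain ⟨δ, a, B, c₁, hδ, ha, hc₁, h⟩ := hSD
  have hB1 : 0 < |B| + 1 := by positivity
  have ha' : a ≠ 0 := ha.ne'
  set c₀ : ℝ := min (min c₁ 1) (a / (2 * (|B| + 1))) with hc₀_def
  have hc₀pos : 0 < c₀ := lt_min (lt_min hc₁ one_pos) (by positivity)
  refine ⟨δ, c₀, hδ, hc₀pos, fun vlo vhi hvlo hlt hvhi => ?_⟩
  obtain ⟨η₀, hη₀, h'⟩ := h vlo vhi hvlo hlt hvhi
  refine ⟨2 / a, η₀, hη₀, fun η hη ρ hρ c hc hP => ?_⟩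
  have hcc₁ : c ≤ c₁ := hc.2.trans ((min_le_left _ _).trans (min_le_left _ _))
  have hc1 : c ≤ 1 := hc.2.trans ((min_le_left _ _).trans (min_le_right _ _))
  have hca : c ≤ a / (2 * (|B| + 1)) := hc.2.trans (min_le_right _ _)
  have hkey := h' η hη ρ hρ c ⟨hc.1, hcc₁⟩ hP
  have hDc : 0 ≤ Dc k m F η (ρ, c) := Dc_nonneg_of_mem_Icc k m F hη.1.ne' ρ ⟨hc.1, hc1⟩
  -- `B c ∂cP ≤ (a/2) ∂cP`
  have hBc : B * c * Dc k m F η (ρ, c) ≤ a / 2 * Dc k m F η (ρ, c) := by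
    refine mul_le_mul_of_nonneg_right ?_ hDc
    calc B * c ≤ |B| * c := mul_le_mul_of_nonneg_right (le_abs_self B) hc.1
      _ ≤ (|B| + 1) * c := by nlinarith [abs_nonneg B, hc.1]
      _ ≤ (|B| + 1) * (a / (2 * (|B| + 1))) := mul_le_mul_of_nonneg_left hca hB1.le
      _ = a / 2 := by field_simp
  have h2 : a / 2 * Dc k m F η (ρ, c) ≤ Dρ k m F η (ρ, c) := by linarith
  rw [abs_of_nonneg hDc]
  calc Dc k m F η (ρ, c) = 2 / a * (a / 2 * Dc k m F η (ρ, c)) := by field_simp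
    _ ≤ 2 / a * Dρ k m F η (ρ, c) := mul_le_mul_of_nonneg_left h2 (by positivity)
    _ ≤ 2 / a * |Dρ k m F η (ρ, c)| := mul_le_mul_of_nonneg_left (le_abs_self _) (by positivity)

/-! ## The registered reduction: (LOC) → (CONF) → `slopeBounds_corner` -/

/-- **Registered sub-goal `slopeBounds_corner` (corner clause of `stub_slopeBounds`, line
`monotone-product-coordinates`) reduced to its two inputs.**
(LOC) `hloc`: the clause for small interior density — for `k = 2, 3` and a nonempty quad family
there are `δ, c₀ > 0` such that for all levels `0 < vlo < vhi < 1`, with a mesh-uniform `C`,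
`|∂cP| ≤ C |∂ρP|` at the band points with `ρ ∈ [1 - 2δ, 1]`, `c ∈ [0, c₀]` (the near-critical
local comparison of interior pivotality with selector influences at the corner; see
`cornerLocalSlope_of_signedDomination` for its signed-domination form).
(CONF) `hconf`: corner band confinement — for every `c₀ > 0` there is `δ > 0` with
`P_η(ρ, c₀) > v` for every `v < 1`, all small `η` and all `ρ ∈ [1 - 2δ, 1]` (supercriticality of
the interior enhancement of critical coarse percolation near `ρ = 1`, i.e. `c*(ρ) → 0`; an
Aizenman–Grimmett-type statement for `M_k`, not in the tree).
Then the corner clause holds verbatim: `δ = min (min δ_LOC δ_CONF) ¼`; on the band either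
`c ≤ c₀` (use LOC) or `c > c₀`, where `P_η(ρ,c) ≥ P_η(ρ,c₀) > vhi` (`P_mono_c`) contradicts the
band condition.  The admissible path `γ` plays no role. -/
theorem slopeBounds_corner_of_localSlope_of_confinement :
    (∀ k : ℕ, k = 2 ∨ k = 3 → ∀ (m : ℕ) (F : Fin m → Quad (Set.univ : Set ℂ)), 0 < m →
      ∃ δ c₀ : ℝ, 0 < δ ∧ 0 < c₀ ∧ ∀ vlo vhi : ℝ, 0 < vlo → vlo < vhi → vhi < 1 →
        ∃ C η₁ : ℝ, 0 < η₁ ∧ ∀ η ∈ Set.Ioo 0 η₁, ∀ ρ ∈ Set.Icc (1 - 2 * δ) 1,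
          ∀ c ∈ Set.Icc (0 : ℝ) c₀, P k m F η ρ c ∈ Set.Icc vlo vhi →
            |Dc k m F η (ρ, c)| ≤ C * |Dρ k m F η (ρ, c)|) →
    (∀ k : ℕ, k = 2 ∨ k = 3 → ∀ (m : ℕ) (F : Fin m → Quad (Set.univ : Set ℂ)), 0 < m →
      ∀ c₀ : ℝ, 0 < c₀ → ∃ δ : ℝ, 0 < δ ∧ ∀ v : ℝ, v < 1 → ∃ η₁ : ℝ, 0 < η₁ ∧
        ∀ η ∈ Set.Ioo 0 η₁, ∀ ρ ∈ Set.Icc (1 - 2 * δ) 1, v < P k m F η ρ c₀) →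
    ∀ k : ℕ, k = 2 ∨ k = 3 → ∀ γ : unitInterval → ℝ × ℝ, PathOK k γ →
      ∀ (m : ℕ) (F : Fin m → Quad (Set.univ : Set ℂ)), 0 < m → ∃ δ : ℝ, 0 < δ ∧ δ ≤ 1 / 4 ∧
        ∀ vlo vhi : ℝ, 0 < vlo → vlo < vhi → vhi < 1 → ∃ C η₁ : ℝ, 0 < η₁ ∧ ∀ η ∈ Set.Ioo 0 η₁,
          ∀ ρ ∈ Set.Icc (1 - 2 * δ) 1, ∀ c ∈ Set.Icc (0 : ℝ) 1, P k m F η ρ c ∈ Set.Icc vlo vhi →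
            |Dc k m F η (ρ, c)| ≤ C * |Dρ k m F η (ρ, c)| := by
  intro hloc hconf k hk γ _ m F hm
  obtain ⟨δ₁, c₀, hδ₁, hc₀, h1⟩ := hloc k hk m F hm
  obtain ⟨δ₂, hδ₂, h2⟩ := hconf k hk m F hm c₀ hc₀
  refine ⟨min (min δ₁ δ₂) (1 / 4), lt_min (lt_min hδ₁ hδ₂) (by norm_num), min_le_right _ _, ?_⟩
  intro vlo vhi hvlo hlt hvhi
  obtain ⟨C, η₀, hη₀, h1'⟩ := h1 vlo vhi hvlo hlt hvhi
  obtain ⟨η₂, hη₂, h2'⟩ := h2 vhi hvhi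
  refine ⟨C, min η₀ η₂, lt_min hη₀ hη₂, fun η hη ρ hρ c hc hP => ?_⟩
  have hδle₁ : min (min δ₁ δ₂) (1 / 4) ≤ δ₁ := (min_le_left _ _).trans (min_le_left _ _)
  have hδle₂ : min (min δ₁ δ₂) (1 / 4) ≤ δ₂ := (min_le_left _ _).trans (min_le_right _ _)
  have hρ₁ : ρ ∈ Set.Icc (1 - 2 * δ₁) 1 := ⟨by linarith [hρ.1], hρ.2⟩
  have hρ₂ : ρ ∈ Set.Icc (1 - 2 * δ₂) 1 := ⟨by linarith [hρ.1], hρ.2⟩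
  have hη₀' : η ∈ Set.Ioo 0 η₀ := ⟨hη.1, hη.2.trans_le (min_le_left _ _)⟩
  have hη₂' : η ∈ Set.Ioo 0 η₂ := ⟨hη.1, hη.2.trans_le (min_le_right _ _)⟩
  by_cases hcc : c ≤ c₀
  · exact h1' η hη₀' ρ hρ₁ c ⟨hc.1, hcc⟩ hP
  · have hlt' := h2' η hη₂' ρ hρ₂
    have hmono := P_mono_c k m F hη.1.ne' ρ (le_of_not_ge hcc)
    exact absurd (hlt'.trans_le hmono) (not_lt.2 hP.2)

end Summit.CriticalPhenomena.CardyFormulaZ2.Theorems.CardySelfRefinement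

end
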